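import Mathlib
import Summits.KontsevichZagierPeriods.Zeta5Search.Elimination.StepEliminant
import Summits.KontsevichZagierPeriods.Zeta5Search.Elimination.PairEnvelope
import Summits.KontsevichZagierPeriods.Zeta5Search.Elimination.PairMargin
import Summits.KontsevichZagierPeriods.Zeta5Search.Denom.ElimProductRule
import Summits.KontsevichZagierPeriods.Zeta5Search.Criteria
import HarnessLib

/-!
# Step elimination of `ζ(3)`: the margin dichotomy of sub-class E0 (fam-elim E-L8; T4)

Cell `pub-zeta5`, class `elim` (`families/elim/FAMILY.md` §5 P2′/P3/P4, §6 E-L8).  HONEST FRAMING: systematic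
search; no irrationality claim unless certified.  Nothing in this file asserts the irrationality of any constant:
the positive branch is a CRITERION with hypotheses, the negative branch is a no-go.

Setting (road E0 = "step pairs").  ONE family of three-term forms `r n = u n · ξ + w n · η − v n`
(`ξ = ζ(5)`, `η = ζ(3)` is eliminated, rational coefficients) and its shift `n ↦ n + 1`.  The STEP ELIMINANT
`E n = w (n+1) · r n − w n · r (n+1) = stepElim w r n` (`StepEliminant.lean`, E-L2) is free of `η`:
`E n = A n · ξ − B n` with the `2 × 2` minors `A n = w(n+1) u(n) − w(n) u(n+1)` and
`B n = w(n+1) v(n) − w(n) v(n+1)` (`cleared_stepElim_eq`).  E-L2 proved (Poincaré ratio brackets) that when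
`w(n+1)/w(n) → Λ`, `r(n+1)/r(n) → λ`, `Λλ ≠ 0`, `Λ ≠ λ`, then `log |E n| / n → log|Λ| + log|λ|`; in the cell's
units this is `b − c` (`b = log Λ` = growth of the eliminated coefficient, `c = −log λ` = decay of the forms):
the tie of rates between consecutive members yields NO analytic saving.  A multiplier `K n` clearing both minors
(product rule `Denom.minor_dInt'`, packaged as `stepMultiplier`; rate `δ_K`, in the cell's bookkeeping
`δ_K ≤ δ_w + max(δ_u, δ_v)`, smaller only through ARITHMETIC cancellation in the minors) makes `K n · E n` an
INTEGER form in `1, ξ`.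

The file types the resulting DICHOTOMY on the sign of the step margin `μ₀ := c − b − δ_K`
(`= −(δ_K + log|Λ| + log|λ|)`):

* `step_no_go` (T4; the E0 companion of `PairMargin.pair_no_go`, E-L6): if the multiplier has LOWER rate `δ`
  with `δ + log|Λ| + log|λ| > 0` (`μ₀ < 0`) then the cleared step eliminant has that positive lower rate and does
  NOT tend to `0` — no irrationality certificate from the step pairs of this family (for any partner index
  shift the same holds by FAMILY.md P4/P5; this file does the unit shift).  Every family on file has `μ₀ < 0`
  (FAMILY.md §11: Zudilin's 2002 pair `μ₀ = −5.91` nats/step with the proved denominators, `−3.91` with the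
  observed ones; the Brown–Zudilin record module `−18.05`).
* `irrational_of_step_elimination` (road E0 of FAMILY.md P3, the positive branch): if the cleared minors are
  integers, `K n ≠ 0` eventually, `K` has UPPER rate `δ` and `δ + log|Λ| + log|λ| < 0` (`μ₀ > 0`), then `ξ`
  is irrational (`Zeta5Search.irrational_of_int_linear_forms`; the non-vanishing comes for free from `Λ ≠ λ`,
  `StepEliminant.stepElim_eventually_ne_zero`).  `irrational_of_step_elimination'` is the same with the
  product-rule multiplier.

HONEST LABEL of the positive branch: it is NOT new mathematics.  With `δ_K = δ_w + δ_v` its hypothesis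
`c − b − δ_v − δ_w > 0` is exactly the exponent condition of Fischler–Zudilin's refinement of Nesterenko's
criterion [FischlerZudilin2010, Theorem 2] — tree
`Literature.NumberTheory.Irrationality.FischlerZudilin2010.theorem2_holds` (PROVED), whose conclusion
`dim_ℚ (ℚ + ℚ η + ℚ ξ) ≥ 3` is STRONGER and whose printed proof (loc. cit. §2.2, Proposition 1) runs through these
very `2 × 2` determinants of consecutive coefficient vectors.  The branch is recorded only so that the typed
envelope of class `elim` is complete and uniform — cross-family pairs: `pair_no_go` (E-L6); step pairs:
`step_no_go` / `irrational_of_step_elimination` (here); short integer relations among `ζ(3)`-coefficients: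
`LatticeCriterion` / `LatticeSandwich` (E-L4 / E-L7) — and so that a certified instance, should any lane ever
produce a family with `μ₀ > 0`, has a one-line landing spot.  Inside E0 the only lever is the arithmetic of the
minors (FAMILY.md §3 "canc"), which enters here solely through the hypothesis on `K`.
-/

open Filter Topology

namespace Summit.KontsevichZagierPeriods.Zeta5Search.Elimination

open Summit.KontsevichZagierPeriods.Zeta5Search.Denom

/-! ### 1. A decay lemma and the two rates of the step eliminant (from E-L2) -/

/-- A sequence with NEGATIVE upper exponential rate tends to `0`. [folklore] -/
theorem tendsto_zero_of_rateLE_neg {x : ℕ → ℝ} {a : ℝ} (hx : RateLE x a) (ha : a < 0) :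
    Tendsto x atTop (𝓝 0) := by
  have hq0 : 0 < Real.exp (a / 2) := Real.exp_pos _
  have hq1 : Real.exp (a / 2) < 1 := by
    rw [← Real.exp_zero]
    exact Real.exp_lt_exp.2 (by linarith)
  refine squeeze_zero_norm' ?_ (tendsto_pow_atTop_nhds_zero_of_lt_one hq0.le hq1)
  filter_upwards [hx (-(a / 2)) (by linarith)] with n hn
  rw [Real.norm_eq_abs]
  calc |x n| ≤ Real.exp ((a + -(a / 2)) * n) := hn
    _ = Real.exp (a / 2) ^ n := by
        rw [← Real.exp_nat_mul]
        congr 1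
        ring

/-- UPPER rate of the step eliminant: `log|Λ| + log|λ|` (E-L2 `tendsto_log_abs_stepElim_div` and the bridge
`rateLE_of_tendsto_log_div`). [folklore] -/
theorem stepElim_rateLE (w r : ℕ → ℝ) {Lam lam : ℝ} (N : ℕ)
    (hw : ∀ n, N ≤ n → w n ≠ 0) (hr : ∀ n, N ≤ n → r n ≠ 0)
    (hW : Tendsto (fun n => w (n + 1) / w n) atTop (𝓝 Lam))
    (hR : Tendsto (fun n => r (n + 1) / r n) atTop (𝓝 lam))
    (hLam : Lam ≠ 0) (hlam : lam ≠ 0) (hne : Lam ≠ lam) :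
    RateLE (stepElim w r) (Real.log |Lam| + Real.log |lam|) :=
  rateLE_of_tendsto_log_div (tendsto_log_abs_stepElim_div w r N hw hr hW hR hLam hlam hne)

/-- LOWER rate of the step eliminant: `log|Λ| + log|λ|` (it is eventually non-zero because `Λ ≠ λ`,
E-L2 `stepElim_eventually_ne_zero`). [folklore] -/
theorem stepElim_rateGE (w r : ℕ → ℝ) {Lam lam : ℝ} (N : ℕ)
    (hw : ∀ n, N ≤ n → w n ≠ 0) (hr : ∀ n, N ≤ n → r n ≠ 0)
    (hW : Tendsto (fun n => w (n + 1) / w n) atTop (𝓝 Lam))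
    (hR : Tendsto (fun n => r (n + 1) / r n) atTop (𝓝 lam))
    (hLam : Lam ≠ 0) (hlam : lam ≠ 0) (hne : Lam ≠ lam) :
    RateGE (stepElim w r) (Real.log |Lam| + Real.log |lam|) :=
  rateGE_of_tendsto_log_div (tendsto_log_abs_stepElim_div w r N hw hr hW hR hLam hlam hne)
    (stepElim_eventually_ne_zero w r N hw hr hW hR hne)

/-! ### 2. The negative branch: STEP NO-GO (T4) -/

/-- **STEP NO-GO (sub-class E0; FAMILY.md P2′/P3).**  Let `w(n+1)/w(n) → Λ ≠ 0`, `r(n+1)/r(n) → λ ≠ 0`,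
`Λ ≠ λ` (both sequences non-zero from `N` on), and let the multiplier `K` have lower exponential rate `δ`.
If `δ + log|Λ| + log|λ| > 0` — in the cell's units: step margin `μ₀ = c − b − δ_K < 0` — then the cleared
step eliminant `K n · (w(n+1) r(n) − w(n) r(n+1))` has the positive lower rate `δ + log|Λ| + log|λ|` and does
not tend to `0`: the step pair certifies nothing. -/
theorem step_no_go {K w r : ℕ → ℝ} {Lam lam δ : ℝ} (N : ℕ)
    (hw : ∀ n, N ≤ n → w n ≠ 0) (hr : ∀ n, N ≤ n → r n ≠ 0)
    (hW : Tendsto (fun n => w (n + 1) / w n) atTop (𝓝 Lam))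
    (hR : Tendsto (fun n => r (n + 1) / r n) atTop (𝓝 lam))
    (hLam : Lam ≠ 0) (hlam : lam ≠ 0) (hne : Lam ≠ lam)
    (hK : RateGE K δ) (hpos : 0 < δ + (Real.log |Lam| + Real.log |lam|)) :
    RateGE (fun n => K n * stepElim w r n) (δ + (Real.log |Lam| + Real.log |lam|)) ∧
      ¬ Tendsto (fun n => K n * stepElim w r n) atTop (𝓝 0) := by
  have h : RateGE (fun n => K n * stepElim w r n) (δ + (Real.log |Lam| + Real.log |lam|)) :=
    rateGE_mul hK (stepElim_rateGE w r N hw hr hW hR hLam hlam hne)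
  exact ⟨h, not_tendsto_zero_of_rateGE_pos h hpos⟩

/-! ### 3. Integrality of the cleared step eliminant (product rule) -/

/-- The cleared step eliminant of `r n = u n ξ + w n η − v n` is an INTEGER form in `1, ξ`: if `K n` clears the
minors `A n = w(n+1) u(n) − w(n) u(n+1)` and `B n = w(n+1) v(n) − w(n) v(n+1)`, then
`K n · stepElim w r n = a n + b n · ξ` with `a n = −K n · B n ∈ ℤ`, `b n = K n · A n ∈ ℤ`
(the `η`-terms cancel identically). -/
theorem cleared_stepElim_eq {u w v : ℕ → ℚ} {K : ℕ → ℕ} {ξ η : ℝ} {r : ℕ → ℝ}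
    (hr : ∀ n, r n = (u n : ℝ) * ξ + (w n : ℝ) * η - (v n : ℝ))
    (hA : ∀ n, (w (n + 1) * u n - w n * u (n + 1)) ∈ dInt (K n))
    (hB : ∀ n, (w (n + 1) * v n - w n * v (n + 1)) ∈ dInt (K n)) :
    ∃ a b : ℕ → ℤ, ∀ n,
      (a n : ℝ) + (b n : ℝ) * ξ = (K n : ℝ) * stepElim (fun m => (w m : ℝ)) r n := by
  choose zA hzA using fun n => mem_dInt.1 (hA n)
  choose zB hzB using fun n => mem_dInt.1 (hB n)
  refine ⟨fun n => -zB n, zA, fun n => ?_⟩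
  have hA' : ((zA n : ℤ) : ℝ) =
      (K n : ℝ) * ((w (n + 1) : ℝ) * (u n : ℝ) - (w n : ℝ) * (u (n + 1) : ℝ)) := by
    have h := congrArg (fun q : ℚ => (q : ℝ)) (hzA n)
    push_cast at h
    linarith
  have hB' : ((zB n : ℤ) : ℝ) =
      (K n : ℝ) * ((w (n + 1) : ℝ) * (v n : ℝ) - (w n : ℝ) * (v (n + 1) : ℝ)) := by
    have h := congrArg (fun q : ℚ => (q : ℝ)) (hzB n)
    push_cast at h
    linarith
  simp only [stepElim, hr, Int.cast_neg]
  linear_combination ξ * hA' - hB'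

/-- The PRODUCT-RULE step multiplier for per-coordinate denominators `Du, Dw, Dv` of `u, w, v`
(`Denom.minor_dInt'` for the two minors of the step pair). -/
def stepMultiplier (Du Dw Dv : ℕ → ℕ) (n : ℕ) : ℕ :=
  Nat.lcm (Nat.lcm (Dw (n + 1) * Du n) (Dw n * Du (n + 1)))
    (Nat.lcm (Dw (n + 1) * Dv n) (Dw n * Dv (n + 1)))

/-- The product-rule step multiplier is positive when all denominators are. -/
theorem stepMultiplier_pos {Du Dw Dv : ℕ → ℕ}
    (hu : ∀ n, 0 < Du n) (hw : ∀ n, 0 < Dw n) (hv : ∀ n, 0 < Dv n) (n : ℕ) :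
    0 < stepMultiplier Du Dw Dv n :=
  Nat.lcm_pos (Nat.lcm_pos (Nat.mul_pos (hw _) (hu _)) (Nat.mul_pos (hw _) (hu _)))
    (Nat.lcm_pos (Nat.mul_pos (hw _) (hv _)) (Nat.mul_pos (hw _) (hv _)))

/-- The product-rule step multiplier clears both minors of the step pair (`Denom.minor_dInt'`). -/
theorem stepMultiplier_clears {u w v : ℕ → ℚ} {Du Dw Dv : ℕ → ℕ}
    (hu : ∀ n, u n ∈ dInt (Du n)) (hw : ∀ n, w n ∈ dInt (Dw n)) (hv : ∀ n, v n ∈ dInt (Dv n))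
    (n : ℕ) :
    (w (n + 1) * u n - w n * u (n + 1)) ∈ dInt (stepMultiplier Du Dw Dv n) ∧
      (w (n + 1) * v n - w n * v (n + 1)) ∈ dInt (stepMultiplier Du Dw Dv n) :=
  ⟨DInt.mono (Nat.dvd_lcm_left _ _) (minor_dInt' hw hu (n + 1) n),
    DInt.mono (Nat.dvd_lcm_right _ _) (minor_dInt' hw hv (n + 1) n)⟩

/-! ### 4. The positive branch (criterion; DOMINATED by Fischler–Zudilin 2010, Theorem 2) -/

/-- **Irrationality from step elimination (road E0 of FAMILY.md P3; dominated by
`FischlerZudilin2010.theorem2_holds`, see the module docstring).**  One family `r n = u n ξ + w n η − v n` with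
rational coefficients; a multiplier `K n ∈ ℕ`, eventually non-zero, clearing the two step minors and of upper
exponential rate `δ`; ratio limits `w(n+1)/w(n) → Λ ≠ 0`, `r(n+1)/r(n) → λ ≠ 0`, `Λ ≠ λ` (non-vanishing from
`N` on).  If `δ + log|Λ| + log|λ| < 0` — step margin `μ₀ = c − b − δ_K > 0` — then `ξ` is irrational: the
cleared step eliminants are integer forms `a n + b n ξ → 0`, non-zero for all large `n`. -/
theorem irrational_of_step_elimination {u w v : ℕ → ℚ} {K : ℕ → ℕ} {ξ η : ℝ} {r : ℕ → ℝ}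
    {Lam lam δ : ℝ} (N : ℕ)
    (hr : ∀ n, r n = (u n : ℝ) * ξ + (w n : ℝ) * η - (v n : ℝ))
    (hA : ∀ n, (w (n + 1) * u n - w n * u (n + 1)) ∈ dInt (K n))
    (hB : ∀ n, (w (n + 1) * v n - w n * v (n + 1)) ∈ dInt (K n))
    (hK0 : ∀ᶠ n in atTop, K n ≠ 0) (hK : RateLE (fun n => (K n : ℝ)) δ)
    (hw : ∀ n, N ≤ n → w n ≠ 0) (hr0 : ∀ n, N ≤ n → r n ≠ 0)
    (hW : Tendsto (fun n => ((w (n + 1) : ℚ) : ℝ) / ((w n : ℚ) : ℝ)) atTop (𝓝 Lam))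
    (hR : Tendsto (fun n => r (n + 1) / r n) atTop (𝓝 lam))
    (hLam : Lam ≠ 0) (hlam : lam ≠ 0) (hne : Lam ≠ lam)
    (hneg : δ + (Real.log |Lam| + Real.log |lam|) < 0) :
    Irrational ξ := by
  obtain ⟨a, b, hab⟩ := cleared_stepElim_eq hr hA hB
  have hw' : ∀ n, N ≤ n → (fun m => ((w m : ℚ) : ℝ)) n ≠ 0 := fun n hn => by
    simpa using hw n hn
  have hE : RateLE (stepElim (fun m => ((w m : ℚ) : ℝ)) r) (Real.log |Lam| + Real.log |lam|) :=
    stepElim_rateLE _ r N hw' hr0 hW hR hLam hlam hne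
  have hKE : RateLE (fun n => (K n : ℝ) * stepElim (fun m => ((w m : ℚ) : ℝ)) r n)
      (δ + (Real.log |Lam| + Real.log |lam|)) :=
    rateLE_mul hK hE
  have hsmall : Tendsto (fun n => (a n : ℝ) + b n * ξ) atTop (𝓝 0) :=
    (tendsto_zero_of_rateLE_neg hKE hneg).congr (fun n => (hab n).symm)
  have hEne := stepElim_eventually_ne_zero (fun m => ((w m : ℚ) : ℝ)) r N hw' hr0 hW hR hne
  have hne' : ∃ᶠ n : ℕ in atTop, (a n : ℝ) + b n * ξ ≠ 0 := by
    refine Filter.Eventually.frequently ?_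
    filter_upwards [hEne, hK0] with n h1 h2
    rw [hab n]
    exact mul_ne_zero (by exact_mod_cast h2) h1
  exact irrational_of_int_linear_forms a b hsmall hne'

/-- The positive branch with the PRODUCT-RULE multiplier `stepMultiplier Du Dw Dv` (per-coordinate denominators
`Du n · u n, Dw n · w n, Dv n · v n ∈ ℤ`, all `D > 0`): only the upper rate `δ` of the multiplier is then a
hypothesis.  (In the cell's bookkeeping `δ = δ_w + max(δ_u, δ_v)` for `d_n`-power denominators; a smaller true
`δ` — FAMILY.md "canc" — is the one lever of road E0 and is fed in through `irrational_of_step_elimination`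
with a better `K`.) -/
theorem irrational_of_step_elimination' {u w v : ℕ → ℚ} {Du Dw Dv : ℕ → ℕ} {ξ η : ℝ} {r : ℕ → ℝ}
    {Lam lam δ : ℝ} (N : ℕ)
    (hr : ∀ n, r n = (u n : ℝ) * ξ + (w n : ℝ) * η - (v n : ℝ))
    (hu : ∀ n, u n ∈ dInt (Du n)) (hwD : ∀ n, w n ∈ dInt (Dw n)) (hv : ∀ n, v n ∈ dInt (Dv n))
    (hDu : ∀ n, 0 < Du n) (hDw : ∀ n, 0 < Dw n) (hDv : ∀ n, 0 < Dv n)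
    (hK : RateLE (fun n => (stepMultiplier Du Dw Dv n : ℝ)) δ)
    (hw : ∀ n, N ≤ n → w n ≠ 0) (hr0 : ∀ n, N ≤ n → r n ≠ 0)
    (hW : Tendsto (fun n => ((w (n + 1) : ℚ) : ℝ) / ((w n : ℚ) : ℝ)) atTop (𝓝 Lam))
    (hR : Tendsto (fun n => r (n + 1) / r n) atTop (𝓝 lam))
    (hLam : Lam ≠ 0) (hlam : lam ≠ 0) (hne : Lam ≠ lam)
    (hneg : δ + (Real.log |Lam| + Real.log |lam|) < 0) :
    Irrational ξ :=
  irrational_of_step_elimination N hr (fun n => (stepMultiplier_clears hu hwD hv n).1)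
    (fun n => (stepMultiplier_clears hu hwD hv n).2)
    (Eventually.of_forall fun n => (stepMultiplier_pos hDu hDw hDv n).ne') hK hw hr0 hW hR hLam
    hlam hne hneg

end Summit.KontsevichZagierPeriods.Zeta5Search.Elimination
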